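/-
Copyright (c) 2026 the pub-hodgecm-mathlib formalisation cell (harness21).  Prover seat hodgecm-mathlib-F0P3a-p01 (g32), req620 Track A «(D-RAM) FOUR-FRAME» squad
(unit U3_Laws, (KMS) road «MODULO κ-STAGE B», κ-ASSEMBLER «UNSIGNED PAIR», dealer LH4-plan (g11) WORD #53 (1): the PAYER of (κ-B₀) `stub_U3_kappaCount_typeZero`
(tree `Cruxes/H413/Lines/F0_P3c_DyRamFourFrame_U3_Laws.lean` ED. 10 :487) MODULO the κ-BOX-SUM identity of LH4-p14 (g3) (statement frozen in his skeleton
`KSB0-KappaSignCountTypeZero.SKELETON.v1` 9ee9a0d6f62b36d2, binder `hbox` VERBATIM); every κ-socket is ★).  2026-09-04.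
-/
import Summits.HodgeConjecture.HodgeConjecture.Theorems.F0P3cDyRamDiagonalKappaSplitCountSockets   -- ★ p856661 (LH4-p04 (g2)): the four type-0 T-strata κ-sockets (core∕T1∕T2∕T3); brings ★ KappaCountDefs∕Eval (LH4-p05), ★ B4, ★ StrataDefs∕TorusDefs, ★ LocalFields (ω-conductor toolkit)
import Summits.HodgeConjecture.HodgeConjecture.Theorems.F0P3cDyRamDiagonalKappaGluedSocket        -- ★ p856706 (LH4-p09 (g3)): κB-G socket foot 0 `finsum_kappaCount_mul_stabiliserWeight_hasAxis_G1`
import Summits.HodgeConjecture.HodgeConjecture.Theorems.F0P3cDyRamDiagonalKappaGluedRotations     -- ★ (LH4-p13 (g3)): the rotated κB-G sockets `…_hasAxis_G2 ∕ _G3` (feet on B₂, B₃) through ★ p856797 «κ-PERMUTATION RULE»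
import Summits.HodgeConjecture.HodgeConjecture.Theorems.F0P3cDyRamDiagonalKappaCoreHangingSocket  -- ★ p856750 (LH4-p08 (g3)): κB-H socket `finsum_kappaCount_mul_stabiliserWeight_hasAxis_H`
import Summits.HodgeConjecture.HodgeConjecture.Theorems.F0P3cDyRamStableCountTypeZero              -- ★ p856280 (LH4-p10 (g2)): B10 tools `finite_normalisedStableLattices`; brings ★ PART 1 `finsum_mem_eq_sum_box_finsum_mem_hasAxis`, ★ B3 `hasAxis_shapes`, ★ StrataAxis, ★ ElementDatumParity
import Summits.HodgeConjecture.HodgeConjecture.Theorems.F0P3cDyRamGlueUnitRationalityDepth           -- ★ (LH4-p09 (g2)): `exists_fixed_v_add_glueUnit_le_iff` (the glue witnesses `f₀`)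
import Summits.HodgeConjecture.HodgeConjecture.Theorems.F0P3cDyRamDiagonalPermutation              -- ★ §P (LH4-p13 (g2)): `isElementDatum_swap`, `isElementDatum_rescale` (element data of the rotated feet)
import Summits.HodgeConjecture.HodgeConjecture.Theorems.F0P3cDyRamFourFrameLawDefsR                 -- ★ DEFS LEAF №1-R p855074: `shiftR`
import Summits.HodgeConjecture.HodgeConjecture.Theorems.F0P3cDyRamKappaAssemblyTools                -- (this seat): `exists_glue_witness`, `abs_cast_normSign`, `normSign_one_add_eq_one`
import HarnessLib

/-!
# Crux `H413`, line LH4 «(D-RAM) FOUR-FRAME» road — unit U3_Laws (iii), (KMS) road «MODULO κ-STAGE B»: THE (κ-B₀) PAYER MODULO κ-BOX-SUM —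
# `|Σᶠ_{M ∈ 𝓛₀(T), dualisable} κ₀,ᵢ(M)·w(M)| = ampl(q, k, B)∕4` from the seven ★ type-0 κ-sockets and the box-sum arithmetic

Cell `hodgecm-mathlib` (D-0151), FLOOR 0, crux item H413 = `stmt-HodgeConjecture-24833`, route of record `HCCMUnconditional`; squad F0∕P3c∕LH4 (req618∕req620); registered stub served:
`F0P3cDyRamFourFrameU3.stub_U3_kappaCount_typeZero` ((κ-B₀), U3 ED. 10 :487; the `hBκ10` binder of ★ Fκ5 ED. 2 `kappaModelSum_of_kappaStageB_complete`).  THEOREMS ONLY (no `def`,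
no instance, no notation, no `sorry`, default heartbeats); lane `--supports stmt-HodgeConjecture-24833 --as helper` (count-neutral).  CONCLUSION = the (κ-B₀) sentence TOKEN FOR TOKEN
(`[CompleteSpace K]`, `depthOfRecord d`, `shiftR d t`, `ampl`); HYPOTHESIS = exactly one ∀-closed arithmetic identity nobody has landed yet, in the letters of LH4-p14 (g3)'s κS
skeleton 9ee9a0d6 (so one U3 pay line `stub_U3_kappaCount_typeZero := kappaCount_typeZero_of_boxSum ‹sum_box_kappa_eq_typeZero›` closes the child when it is ★):
* `hbox` — «κ-BOX-SUM»: the pure arithmetic of the κ-table over the box (LH4-p14 (g3), numerically validated `kappa_boxsum_leanshape.v1` 40f1a7eb, 1995∕1995 rows); its sign tokens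
  `ω`, `εH`, `εG p j` are free letters, instantiated here by the ★ sockets' signs.
ASSEMBLY = the ★ B10 road `StableCountTypeZero.finsum_stabiliserWeight_dualisable_eq` re-run with the signed summand `f M = κ₀,ᵢ(M)·w(M)`: finite partition by axis vector (★ PART 1,
generic in `f`), cells = strata, the κ-table cell by cell (core∕T ★ p856661; G1 ★ p856706 and H ★ p856750 at ONE σ-fixed glue witness of depth `n₁ − d + 1` from ★
`exists_fixed_v_add_glueUnit_le_iff`, serving every shell; G2∕G3 ★ `…KappaGluedRotations` (LH4-p13 (g3)) at the witnesses of the swapped ∕ rescaled element data ★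
`isElementDatum_swap`∕`_rescale`, glue units `(α−1)∕(β−1)` and `(βα⁻¹−1)∕(α⁻¹−1) = (β−α)∕(1−α)`, the G3 socket's `n₂`-based guards rewritten `n₁`-based under `n₁ = n₂`; `0` off
the ★ B3 shape list), then `hbox`; its guards «apex excess ≥ 2d ⇒ glue sign = ω(−1)» hold since there the witness is `2d`-deep (`ω(1+f) = 1`, ★ `normSign_eq_of_near`); finally
`|token| = 1` and `max(0, q^k − q^{k−B}) = q^k − q^{k−B′}`, `B′ = (nᵢ + 2(d%2) + 2 − 3d)∕2` (`shiftR d t = d − d%2`); `d ≥ 2` from `|2| < 1` (★ `eq_succ_of_odd`).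
HONEST LABEL.  Count-neutral (`--supports`); nothing printed is asserted; (κ-B₀)∕(KMS) stay PROVER TARGETS (empirical census law in diagonal-model currency) until κ-BOX-SUM lands; `HC_CM` is proved only modulo the 7 printed citations (2 remaining named inputs: hLiu418 = `stmt-HodgeConjecture-24832`, h413 = `stmt-HodgeConjecture-24833`) until rung 0 closes.

## References
* [Kottwitz1986BaseChangeUnits] R. E. Kottwitz, *Base change for unit elements of Hecke algebras*, Compositio Math. 60 (1986), §1 pp. 240–241 (κ-orbital integrals of units as
  signed lattice counts modulo the torus).
* [Rogawski1990] J. D. Rogawski, *Automorphic Representations of Unitary Groups in Three Variables*, Ann. of Math. Stud. 123 (1990), §4.9 Prop. 4.9.1 (a) p. 55, §4.10 p. 58.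
* [LanglandsShelstad1987] R. P. Langlands, D. Shelstad, *On the definition of transfer factors*, Math. Ann. 278 (1987), §3 (κ as a character of `H¹(F, T)`).
-/

set_option autoImplicit false

noncomputable section

namespace Summit.HodgeConjecture.HodgeConjecture.Cruxes.H413.F0P3cDyRamKappaCountTypeZero

open Finset
open Literature.NumberTheory.Automorphic Literature.NumberTheory.Automorphic.HermitianLattice
open Literature.NumberTheory.Automorphic.UnitaryLatticeTree Literature.NumberTheory.Automorphic.UnitaryThreeFourFrame
open Literature.NumberTheory.LocalFields Literature.NumberTheory.LocalFields.WildQuadraticDatum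
open Summit.HodgeConjecture.HodgeConjecture.Cruxes.H413.F0P3cDyRamFourFrameLawDefsR (shiftR)
open Summit.HodgeConjecture.HodgeConjecture.Cruxes.H413.F0P3cDyRamDiagonalTorusDefs
open Summit.HodgeConjecture.HodgeConjecture.Cruxes.H413.F0P3cDyRamDiagonalStrataDefs
open Summit.HodgeConjecture.HodgeConjecture.Cruxes.H413.F0P3cDyRamDiagonalKappaCountDefs
open Summit.HodgeConjecture.HodgeConjecture.Cruxes.H413.F0P3cDyRamStrataPartition (finsum_mem_eq_sum_box_finsum_mem_hasAxis)
open Summit.HodgeConjecture.HodgeConjecture.Cruxes.H413.F0P3cDyRamDiagonalStrataAxis (exists_hasAxis hasAxis_unique)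
open Summit.HodgeConjecture.HodgeConjecture.Cruxes.H413.F0P3cDyRamDiagonalStrataShapes (hasAxis_shapes)
open Summit.HodgeConjecture.HodgeConjecture.Cruxes.H413.F0P3cDyRamDiagonalKappaSplitCountSockets
open Summit.HodgeConjecture.HodgeConjecture.Cruxes.H413.F0P3cDyRamDiagonalKappaGluedSocket (finsum_kappaCount_mul_stabiliserWeight_hasAxis_G1)
open Summit.HodgeConjecture.HodgeConjecture.Cruxes.H413.F0P3cDyRamDiagonalKappaGluedRotations (finsum_kappaCount_mul_stabiliserWeight_hasAxis_G2 finsum_kappaCount_mul_stabiliserWeight_hasAxis_G3)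
open Summit.HodgeConjecture.HodgeConjecture.Cruxes.H413.F0P3cDyRamDiagonalKappaCoreHangingSocket (finsum_kappaCount_mul_stabiliserWeight_hasAxis_H)
open Summit.HodgeConjecture.HodgeConjecture.Cruxes.H413.F0P3cDyRamElementDatumParity
open Summit.HodgeConjecture.HodgeConjecture.Cruxes.H413.F0P3cDyRamStableCountTypeZero (v_diag_eq_one diag_regular finite_normalisedStableLattices)
open Summit.HodgeConjecture.HodgeConjecture.Cruxes.H413.F0P3cDyRamGlueUnitRationalityDepth (exists_fixed_v_add_glueUnit_le_iff)
open Summit.HodgeConjecture.HodgeConjecture.Cruxes.H413.F0P3cDyRamDiagonalPermutation (isElementDatum_swap isElementDatum_rescale)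
open Summit.HodgeConjecture.HodgeConjecture.Cruxes.H413.F0P3cDyRamKappaAssemblyTools
open Summit.HodgeConjecture.HodgeConjecture.Cruxes.H413.F0P3cDyRamDiagonalKappaCoreHangingClass (two_le_d_of_v_two_lt_one)
open scoped Valued WithZero Matrix MatrixGroups

/-! ## §1  HEAD — (κ-B₀) modulo κ-BOX-SUM -/

/-- **(κ-B₀) MODULO κ-BOX-SUM.**  If the κ-box-sum identity (`hbox`, LH4-p14 (g3)'s letters, sign tokens free) holds, then for every
wild ramified quadratic datum on a complete field with finite residue field, every element datum at the depth of record, `T = diag(α, β, 1)`, `2k + d = n₁ + n₂ + n₃ + 2`, every slot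
`i` and `2B = nᵢ − d + 2 − 2·shiftR d t`: `|Σᶠ_{M ∈ 𝓛₀(T), dualisable} κ₀,ᵢ(M)·w(M)| = ampl(q, k, B)∕4` — the (κ-B₀) child `stub_U3_kappaCount_typeZero` of U3 ED. 10 TOKEN FOR TOKEN.
[cite: Kottwitz1986BaseChangeUnits, §1 pp. 240–241] [cite: Rogawski1990, §4.9 Prop. 4.9.1 (a) p. 55; §4.10 p. 58] [cite: LanglandsShelstad1987, §3] -/
theorem kappaCount_typeZero_of_boxSum
    (hbox : ∀ (q : ℕ) {d n₁ n₂ n₃ Bx k : ℕ}, 2 ≤ d →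
      ((n₁ = n₂ ∧ n₁ ≤ n₃) ∨ (n₁ = n₃ ∧ n₁ ≤ n₂) ∨ (n₂ = n₃ ∧ n₂ ≤ n₁)) →
      d ≤ min n₁ (min n₂ n₃) → n₁ % 2 = d % 2 → n₂ % 2 = d % 2 → n₃ % 2 = d % 2 → n₁ + n₂ + n₃ ≤ Bx →
      2 * k + d = n₁ + n₂ + n₃ + 2 → ∀ (i : Fin 3) (ω εH : ℚ) (εG : Fin 3 → Fin 3 → ℚ),
      (i = 0 → n₂ = n₃ → n₂ + 2 * d ≤ n₁ → εG 0 0 = ω) → (i = 1 → n₁ = n₃ → n₁ + 2 * d ≤ n₂ → εG 1 1 = ω) → (i = 2 → n₁ = n₂ → n₁ + 2 * d ≤ n₃ → εG 2 2 = ω) →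
      ∀ (v : (Fin 3 → ℕ) → ℚ), v ![0, 0, 0] = 0 →
      (∀ s, 1 ≤ s → v ![0, s, s] = if i = 0 ∧ 2 * d ≤ s ∧ 2 ∣ s ∧ s ≤ n₁ then ω * (q : ℚ) ^ (s / 2) else 0) →
      (∀ s, 1 ≤ s → v ![s, 0, s] = if i = 1 ∧ 2 * d ≤ s ∧ 2 ∣ s ∧ s ≤ n₂ then ω * (q : ℚ) ^ (s / 2) else 0) →
      (∀ s, 1 ≤ s → v ![s, s, 0] = if i = 2 ∧ 2 * d ≤ s ∧ 2 ∣ s ∧ s ≤ n₃ then ω * (q : ℚ) ^ (s / 2) else 0) →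
      (∀ ρ s, 1 ≤ ρ → 1 ≤ s → v ![2 * ρ, 2 * ρ + s, 2 * ρ + s] =
        (if 2 ∣ s ∧ 2 * ρ ≤ min n₂ n₃ ∧ 2 * ρ + s ≤ n₁ then
            (![ω * (q : ℚ) ^ (2 * ρ + s / 2 - 1) * ((if 2 * d ≤ s then (q : ℚ) - 1 else 0) - (if s + 2 = 2 * d then 1 else 0)), 0, 0] : Fin 3 → ℚ) i
          else 0) +
        (if 2 ∣ s ∧ n₂ = n₃ ∧ n₁ = n₂ + s ∧ n₂ < 2 * ρ ∧ 2 * ρ - n₂ ≤ n₂ - d + 1 then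
            (![if 2 * d ≤ s + 2 * ((2 * ρ - n₂ + 1) / 2) then εG 0 0 else 0,
               if d ≤ (2 * ρ - n₂ + 1) / 2 then εG 0 1 else 0,
               if d ≤ (2 * ρ - n₂ + 1) / 2 then εG 0 2 else 0] : Fin 3 → ℚ) i * (q : ℚ) ^ (2 * ρ + s / 2 - (2 * ρ - n₂ + 1) / 2)
          else 0)) →
      (∀ ρ s, 1 ≤ ρ → 1 ≤ s → v ![2 * ρ + s, 2 * ρ, 2 * ρ + s] =
        (if 2 ∣ s ∧ 2 * ρ ≤ min n₁ n₃ ∧ 2 * ρ + s ≤ n₂ then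
            (![0, ω * (q : ℚ) ^ (2 * ρ + s / 2 - 1) * ((if 2 * d ≤ s then (q : ℚ) - 1 else 0) - (if s + 2 = 2 * d then 1 else 0)), 0] : Fin 3 → ℚ) i
          else 0) +
        (if 2 ∣ s ∧ n₁ = n₃ ∧ n₂ = n₁ + s ∧ n₁ < 2 * ρ ∧ 2 * ρ - n₁ ≤ n₁ - d + 1 then
            (![if d ≤ (2 * ρ - n₁ + 1) / 2 then εG 1 0 else 0,
               if 2 * d ≤ s + 2 * ((2 * ρ - n₁ + 1) / 2) then εG 1 1 else 0,
               if d ≤ (2 * ρ - n₁ + 1) / 2 then εG 1 2 else 0] : Fin 3 → ℚ) i * (q : ℚ) ^ (2 * ρ + s / 2 - (2 * ρ - n₁ + 1) / 2)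
          else 0)) →
      (∀ ρ s, 1 ≤ ρ → 1 ≤ s → v ![2 * ρ + s, 2 * ρ + s, 2 * ρ] =
        (if 2 ∣ s ∧ 2 * ρ ≤ min n₁ n₂ ∧ 2 * ρ + s ≤ n₃ then
            (![0, 0, ω * (q : ℚ) ^ (2 * ρ + s / 2 - 1) * ((if 2 * d ≤ s then (q : ℚ) - 1 else 0) - (if s + 2 = 2 * d then 1 else 0))] : Fin 3 → ℚ) i
          else 0) +
        (if 2 ∣ s ∧ n₁ = n₂ ∧ n₃ = n₁ + s ∧ n₁ < 2 * ρ ∧ 2 * ρ - n₁ ≤ n₁ - d + 1 then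
            (![if d ≤ (2 * ρ - n₁ + 1) / 2 then εG 2 0 else 0,
               if d ≤ (2 * ρ - n₁ + 1) / 2 then εG 2 1 else 0,
               if 2 * d ≤ s + 2 * ((2 * ρ - n₁ + 1) / 2) then εG 2 2 else 0] : Fin 3 → ℚ) i * (q : ℚ) ^ (2 * ρ + s / 2 - (2 * ρ - n₁ + 1) / 2)
          else 0)) →
      (∀ ρ, 1 ≤ ρ → v ![2 * ρ, 2 * ρ, 2 * ρ] =
        if n₁ = n₂ ∧ n₂ = n₃ ∧ n₁ < 2 * ρ ∧ 2 * ρ - n₁ ≤ n₁ - d + 1 ∧ d ≤ (2 * ρ - n₁ + 1) / 2 then εH * (q : ℚ) ^ (2 * ρ - (2 * ρ - n₁ + 1) / 2) else 0) →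
      (∀ a : Fin 3 → ℕ, ¬ ((a = ![0, 0, 0]) ∨
        (∃ s, 2 ∣ s ∧ 2 ≤ s ∧ (a = ![0, s, s] ∨ a = ![s, 0, s] ∨ a = ![s, s, 0])) ∨
        (∃ ρ s, 1 ≤ ρ ∧ 2 ∣ s ∧ 2 ≤ s ∧ (a = ![2 * ρ, 2 * ρ + s, 2 * ρ + s] ∨ a = ![2 * ρ + s, 2 * ρ, 2 * ρ + s] ∨ a = ![2 * ρ + s, 2 * ρ + s, 2 * ρ])) ∨
        (∃ ρ, 1 ≤ ρ ∧ a = ![2 * ρ, 2 * ρ, 2 * ρ])) → v a = 0) →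
      ((q : ℚ) - 1) * ∑ a : Fin 3 → Fin (Bx + 1), v (fun j => (a j : ℕ)) =
        (if n₁ = n₂ ∧ n₂ = n₃ then εH else if n₂ = n₃ then εG 0 i else if n₁ = n₃ then εG 1 i else εG 2 i) *
          ((q : ℚ) ^ k - (q : ℚ) ^ (k - ((![n₁, n₂, n₃] : Fin 3 → ℕ) i + 2 * (d % 2) + 2 - 3 * d) / 2)))
    :
    ∀ {K : Type} [Field K] [Valued K ℤᵐ⁰] [CompleteSpace K] [Fintype 𝓀[K]] {σ : K →+* K} {ϖ : K} {d t : ℕ}, IsRamifiedQuadraticDatum σ ϖ d t →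
      Valued.v (2 : K) < 1 → ∀ {α β : K} {n₁ n₂ n₃ : ℕ}, IsElementDatum σ ϖ (depthOfRecord d) α β n₁ n₂ n₃ →
      ∀ (T : GL (Fin 3) K), (T : Matrix (Fin 3) (Fin 3) K) = Matrix.diagonal ![α, β, 1] → ∀ (k : ℕ), 2 * k + d = n₁ + n₂ + n₃ + 2 →
      ∀ (i : Fin 3) (B : ℤ), 2 * B = ((![n₁, n₂, n₃] : Fin 3 → ℕ) i : ℤ) - d + 2 - 2 * shiftR d t →
        |∑ᶠ M ∈ {M : Submodule 𝒪[K] (Fin 3 → K) | M ∈ normalisedStableLattices T ∧ IsDualisableLattice σ ϖ M},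
            (kappaCount σ ϖ 0 i M : ℚ) * stabiliserWeight σ M| = ampl (Fintype.card 𝓀[K]) k B / 4 := by
  intro K _ _ _ _ σ ϖ d t hD h2 α β n₁ n₂ n₃ hE T hT k hk i B hB
  have hD' := hD
  obtain ⟨hσ, hvσ, hϖ, hfix, hdϖ, hd1, -⟩ := hD'
  have hd2 : 2 ≤ d := two_le_d_of_v_two_lt_one hD h2
  have hN₀ : d ≤ depthOfRecord d := by unfold depthOfRecord; split_ifs <;> omega
  have hϖ1 : Valued.v ϖ ≤ 1 := by rw [hϖ, ← WithZero.exp_zero, WithZero.exp_le_exp]; norm_num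
  have hE' := hE
  obtain ⟨hαn, hβn, hαβ, hα1, hβ1, h₁, h₂, h₃, hN₁, hN₂, hN₃⟩ := hE'
  -- (1) the summation set is finite and partitioned by axis vector over the box `[0, n₁+n₂+n₃]³`
  set S : Set (Submodule 𝒪[K] (Fin 3 → K)) := {M | M ∈ normalisedStableLattices T ∧ IsDualisableLattice σ ϖ M} with hS_def
  have hS : S.Finite := (finite_normalisedStableLattices hD hE T hT).subset fun M hM => hM.1
  have huniq : ∀ (M : Submodule 𝒪[K] (Fin 3 → K)) (a a' : Fin 3 → ℕ), HasAxis ϖ M a → HasAxis ϖ M a' → a = a' :=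
    fun M a a' ha ha' => hasAxis_unique hϖ ha ha'
  have haxis : ∀ M ∈ S, ∃ a : Fin 3 → ℕ, HasAxis ϖ M a ∧ ∀ j, a j ≤ n₁ + n₂ + n₃ :=
    fun M hM => exists_hasAxis hD hE hT hM.1
  rw [finsum_mem_eq_sum_box_finsum_mem_hasAxis huniq S hS (n₁ + n₂ + n₃) haxis (fun M => (kappaCount σ ϖ 0 i M : ℚ) * stabiliserWeight σ M)]
  -- (2) each cell is a stratum
  have hcell : ∀ a : Fin 3 → ℕ, {M | M ∈ S ∧ HasAxis ϖ M a} = stratum σ ϖ T a := fun a => by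
    ext M
    rw [mem_stratum_iff, Set.mem_setOf_eq, hS_def, Set.mem_setOf_eq, and_assoc]
  simp_rw [hcell]
  -- (3) the glue witnesses of the three feet (foot 0 ∕ H share `(β−1)∕(α−1)`; feet 1, 2 live on the swapped ∕ rescaled element data)
  obtain ⟨f₀, hσf₀, hf₀⟩ := exists_glue_witness hD hE hN₀
  obtain ⟨f₁, hσf₁, hf₁⟩ := exists_glue_witness hD (isElementDatum_swap hE) hN₀
  obtain ⟨f₂, hσf₂, hf₂'⟩ := exists_glue_witness hD (isElementDatum_rescale hvσ hE) hN₀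
  have hα0 : α ≠ 0 := fun h => by rw [h, zero_mul] at hαn; exact zero_ne_one hαn
  have hf₂ : n₂ = n₁ → n₂ ≤ n₃ → Valued.v (f₂ + (β - α) / (1 - α)) ≤ Valued.v ϖ ^ (n₃ - d + 1) := by
    intro h21 h23
    -- the glue unit of the rescaled datum: `(βα⁻¹ − 1)∕(α⁻¹ − 1) = (β − α)∕(1 − α)` (as in ★ `…KappaGluedRotations`)
    have key : (β * α⁻¹ - 1) / (α⁻¹ - 1) = (β - α) / (1 - α) := by
      have h1α : (1 : K) - α ≠ 0 := sub_ne_zero.2 (Ne.symm hα1)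
      have hi : α⁻¹ - 1 = (1 - α) * α⁻¹ := by field_simp
      have hn : β * α⁻¹ - 1 = (β - α) * α⁻¹ := by field_simp
      rw [hi, hn, mul_div_mul_right _ _ (inv_ne_zero hα0)]
    rw [← key]; exact hf₂' h21 h23
  -- (4) the glue-shell guards of the four socket families from the three witnesses
  have hglue₀ : ∀ ρ s : ℕ, 2 ∣ s → n₂ = n₃ → n₁ = n₂ + s → n₂ < 2 * ρ → 2 * ρ - n₂ ≤ n₂ - d + 1 →
      Valued.v (f₀ + (β - 1) / (α - 1)) ≤ Valued.v ϖ ^ (2 * ρ + s - n₂) := fun ρ s _ h23 h1s hlt hle =>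
    (hf₀ h23 (by omega)).trans (pow_le_pow_right_of_le_one' hϖ1 (by omega))
  have hglue₁ : ∀ ρ s : ℕ, 2 ∣ s → n₁ = n₃ → n₂ = n₁ + s → n₁ < 2 * ρ → 2 * ρ - n₁ ≤ n₁ - d + 1 →
      Valued.v (f₁ + (α - 1) / (β - 1)) ≤ Valued.v ϖ ^ (2 * ρ + s - n₁) := fun ρ s _ h13 h2s hlt hle =>
    (hf₁ h13 (by omega)).trans (pow_le_pow_right_of_le_one' hϖ1 (by omega))
  have hglue₂ : ∀ ρ s : ℕ, 2 ∣ s → n₂ = n₁ → n₃ = n₂ + s → n₂ < 2 * ρ → 2 * ρ - n₂ ≤ n₂ - d + 1 →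
      Valued.v (f₂ + (β - α) / (1 - α)) ≤ Valued.v ϖ ^ (2 * ρ + s - n₂) := fun ρ s _ h21 h3s hlt hle =>
    (hf₂ h21 (by omega)).trans (pow_le_pow_right_of_le_one' hϖ1 (by omega))
  have hglueH : ∀ ρ : ℕ, n₁ = n₂ → n₂ = n₃ → n₁ < 2 * ρ → 2 * ρ - n₁ ≤ n₁ - d + 1 →
      Valued.v (f₀ + (β - 1) / (α - 1)) ≤ Valued.v ϖ ^ (2 * ρ - n₁) := fun ρ h12 h23 hlt hle =>
    (hf₀ h23 (by omega)).trans (pow_le_pow_right_of_le_one' hϖ1 (by omega))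
  -- the «apex with excess ≥ 2d» guards: there the glue witness is `2d`-deep, so `ω(1 + f) = 1`
  have hvϖ0 : Valued.v ϖ ≠ 0 := by rw [hϖ]; exact WithZero.coe_ne_zero
  have hdeep : ∀ {f g : K} {e m : ℕ}, Valued.v (f + g) ≤ Valued.v ϖ ^ e → Valued.v g = Valued.v ϖ ^ m → 2 * d ≤ e → 2 * d ≤ m →
      Valued.v f ≤ Valued.v ϖ ^ (2 * d) := by
    intro f g e m hfg hg he hm
    have ef : f = (f + g) - g := by ring
    rw [ef]
    refine (Valuation.map_sub _ _ _).trans (max_le ?_ ?_)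
    · exact hfg.trans (pow_le_pow_right_of_le_one' hϖ1 he)
    · rw [hg]; exact pow_le_pow_right_of_le_one' hϖ1 hm
  have hβ0 : β ≠ 0 := fun h => by rw [h, zero_mul] at hβn; exact zero_ne_one hβn
  have hω0 : i = 0 → n₂ = n₃ → n₂ + 2 * d ≤ n₁ →
      (![![(normSign σ (-1 : K) : ℚ) * normSign σ (1 + f₀), (normSign σ (-1 : K) : ℚ) * normSign σ f₀ * normSign σ (1 + f₀), (normSign σ f₀ : ℚ)],
         ![(normSign σ (-1 : K) : ℚ) * normSign σ f₁ * normSign σ (1 + f₁), (normSign σ (-1 : K) : ℚ) * normSign σ (1 + f₁), (normSign σ f₁ : ℚ)],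
         ![(normSign σ f₂ : ℚ), (normSign σ (-1 : K) : ℚ) * normSign σ f₂ * normSign σ (1 + f₂), (normSign σ (-1 : K) : ℚ) * normSign σ (1 + f₂)]] : Fin 3 → Fin 3 → ℚ) 0 0 =
        (normSign σ (-1 : K) : ℚ) := by
    intro _ h23 hle
    have hg : Valued.v ((β - 1) / (α - 1)) = Valued.v ϖ ^ (n₁ - n₂) := by
      rw [map_div₀, h₁, h₂, div_eq_iff (pow_ne_zero _ hvϖ0), ← pow_add, Nat.sub_add_cancel (by omega)]
    have h1 := normSign_one_add_eq_one hD hσf₀ (hdeep (hf₀ h23 (by omega)) hg (by omega) (by omega))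
    show (normSign σ (-1 : K) : ℚ) * normSign σ (1 + f₀) = _
    rw [h1, Int.cast_one, mul_one]
  have hω1 : i = 1 → n₁ = n₃ → n₁ + 2 * d ≤ n₂ →
      (![![(normSign σ (-1 : K) : ℚ) * normSign σ (1 + f₀), (normSign σ (-1 : K) : ℚ) * normSign σ f₀ * normSign σ (1 + f₀), (normSign σ f₀ : ℚ)],
         ![(normSign σ (-1 : K) : ℚ) * normSign σ f₁ * normSign σ (1 + f₁), (normSign σ (-1 : K) : ℚ) * normSign σ (1 + f₁), (normSign σ f₁ : ℚ)],
         ![(normSign σ f₂ : ℚ), (normSign σ (-1 : K) : ℚ) * normSign σ f₂ * normSign σ (1 + f₂), (normSign σ (-1 : K) : ℚ) * normSign σ (1 + f₂)]] : Fin 3 → Fin 3 → ℚ) 1 1 =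
        (normSign σ (-1 : K) : ℚ) := by
    intro _ h13 hle
    have hg : Valued.v ((α - 1) / (β - 1)) = Valued.v ϖ ^ (n₂ - n₁) := by
      rw [map_div₀, h₁, h₂, div_eq_iff (pow_ne_zero _ hvϖ0), ← pow_add, Nat.sub_add_cancel (by omega)]
    have h1 := normSign_one_add_eq_one hD hσf₁ (hdeep (hf₁ h13 (by omega)) hg (by omega) (by omega))
    show (normSign σ (-1 : K) : ℚ) * normSign σ (1 + f₁) = _
    rw [h1, Int.cast_one, mul_one]
  have hω2 : i = 2 → n₁ = n₂ → n₁ + 2 * d ≤ n₃ →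
      (![![(normSign σ (-1 : K) : ℚ) * normSign σ (1 + f₀), (normSign σ (-1 : K) : ℚ) * normSign σ f₀ * normSign σ (1 + f₀), (normSign σ f₀ : ℚ)],
         ![(normSign σ (-1 : K) : ℚ) * normSign σ f₁ * normSign σ (1 + f₁), (normSign σ (-1 : K) : ℚ) * normSign σ (1 + f₁), (normSign σ f₁ : ℚ)],
         ![(normSign σ f₂ : ℚ), (normSign σ (-1 : K) : ℚ) * normSign σ f₂ * normSign σ (1 + f₂), (normSign σ (-1 : K) : ℚ) * normSign σ (1 + f₂)]] : Fin 3 → Fin 3 → ℚ) 2 2 =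
        (normSign σ (-1 : K) : ℚ) := by
    intro _ h12 hle
    have hg : Valued.v ((β - α) / (1 - α)) = Valued.v ϖ ^ (n₃ - n₂) := by
      rw [map_div₀, Valuation.map_sub_swap _ β α, h₃, Valuation.map_sub_swap _ 1 α, h₂, div_eq_iff (pow_ne_zero _ hvϖ0), ← pow_add,
        Nat.sub_add_cancel (by omega)]
    have h1 := normSign_one_add_eq_one hD hσf₂ (hdeep (hf₂ h12.symm (by omega)) hg (by omega) (by omega))
    show (normSign σ (-1 : K) : ℚ) * normSign σ (1 + f₂) = _
    rw [h1, Int.cast_one, mul_one]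
  -- the foot-2 socket ★ `…_hasAxis_G3` is typed `n₂`-based (`n₂ = n₁`, `min n₂ n₁`, `⌈(2ρ−n₂)∕2⌉`); `hbox` reads it `n₁`-based
  have hG3' : ∀ ρ s : ℕ, 1 ≤ ρ → 1 ≤ s → ∑ᶠ M ∈ stratum σ ϖ T ![2 * ρ + s, 2 * ρ + s, 2 * ρ], (kappaCount σ ϖ 0 i M : ℚ) * stabiliserWeight σ M =
      (if 2 ∣ s ∧ 2 * ρ ≤ min n₁ n₂ ∧ 2 * ρ + s ≤ n₃ then
          (![0, 0, (normSign σ (-1 : K) : ℚ) * (Fintype.card 𝓀[K] : ℚ) ^ (2 * ρ + s / 2 - 1) *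
              ((if 2 * d ≤ s then (Fintype.card 𝓀[K] : ℚ) - 1 else 0) - (if s + 2 = 2 * d then 1 else 0))] : Fin 3 → ℚ) i
        else 0) +
      (if 2 ∣ s ∧ n₁ = n₂ ∧ n₃ = n₁ + s ∧ n₁ < 2 * ρ ∧ 2 * ρ - n₁ ≤ n₁ - d + 1 then
          (![if d ≤ (2 * ρ - n₁ + 1) / 2 then (normSign σ f₂ : ℚ) else 0,
             if d ≤ (2 * ρ - n₁ + 1) / 2 then (normSign σ (-1 : K) : ℚ) * normSign σ f₂ * normSign σ (1 + f₂) else 0,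
             if 2 * d ≤ s + 2 * ((2 * ρ - n₁ + 1) / 2) then (normSign σ (-1 : K) : ℚ) * normSign σ (1 + f₂) else 0] : Fin 3 → ℚ) i *
            (Fintype.card 𝓀[K] : ℚ) ^ (2 * ρ + s / 2 - (2 * ρ - n₁ + 1) / 2)
        else 0) := by
    intro ρ s hρ hs
    rw [finsum_kappaCount_mul_stabiliserWeight_hasAxis_G3 hD h2 hE hN₀ hT ρ s hρ hs i f₂ hσf₂ (hglue₂ ρ s), min_comm n₂ n₁]
    by_cases h12 : n₁ = n₂
    · rw [← h12]
    · have h21 : ¬ n₂ = n₁ := fun h => h12 h.symm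
      simp only [h12, h21, false_and, and_false, if_false]
  -- off the ★ B3 shape list a stratum is empty
  have hzero : ∀ a : Fin 3 → ℕ, ¬ ((a = ![0, 0, 0]) ∨
      (∃ s, 2 ∣ s ∧ 2 ≤ s ∧ (a = ![0, s, s] ∨ a = ![s, 0, s] ∨ a = ![s, s, 0])) ∨
      (∃ ρ s, 1 ≤ ρ ∧ 2 ∣ s ∧ 2 ≤ s ∧ (a = ![2 * ρ, 2 * ρ + s, 2 * ρ + s] ∨ a = ![2 * ρ + s, 2 * ρ, 2 * ρ + s] ∨ a = ![2 * ρ + s, 2 * ρ + s, 2 * ρ])) ∨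
      (∃ ρ, 1 ≤ ρ ∧ a = ![2 * ρ, 2 * ρ, 2 * ρ])) →
      (fun a => ∑ᶠ M ∈ stratum σ ϖ T a, (kappaCount σ ϖ 0 i M : ℚ) * stabiliserWeight σ M) a = 0 := by
    intro a ha
    have hempty : stratum σ ϖ T a = ∅ :=
      Set.eq_empty_of_forall_notMem fun M hM => by
        obtain ⟨hM₀, hdual, hax⟩ := (mem_stratum_iff σ ϖ T a M).1 hM
        exact ha (hasAxis_shapes hD hM₀ hdual hax)
    show ∑ᶠ M ∈ stratum σ ϖ T a, (kappaCount σ ϖ 0 i M : ℚ) * stabiliserWeight σ M = 0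
    rw [hempty, finsum_mem_empty]
  -- (5) the box sum
  obtain ⟨hp1, hp2, hp3⟩ := depth_mod_two_eq_of_isElementDatum hD hE hN₀
  have key := hbox (Fintype.card 𝓀[K]) hd2 (isoceles_of_isElementDatum hD hE) (le_min_depth_of_isElementDatum hE hN₀) hp1 hp2 hp3 le_rfl hk i
    ((normSign σ (-1 : K) : ℚ))
    ((((![normSign σ (-(1 + f₀)), normSign σ f₀ * normSign σ (-(1 + f₀)), normSign σ f₀] : Fin 3 → ℤ) i : ℤ) : ℚ))
    (![![(normSign σ (-1 : K) : ℚ) * normSign σ (1 + f₀), (normSign σ (-1 : K) : ℚ) * normSign σ f₀ * normSign σ (1 + f₀), (normSign σ f₀ : ℚ)],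
       ![(normSign σ (-1 : K) : ℚ) * normSign σ f₁ * normSign σ (1 + f₁), (normSign σ (-1 : K) : ℚ) * normSign σ (1 + f₁), (normSign σ f₁ : ℚ)],
       ![(normSign σ f₂ : ℚ), (normSign σ (-1 : K) : ℚ) * normSign σ f₂ * normSign σ (1 + f₂), (normSign σ (-1 : K) : ℚ) * normSign σ (1 + f₂)]])
    hω0 hω1 hω2
    (fun a => ∑ᶠ M ∈ stratum σ ϖ T a, (kappaCount σ ϖ 0 i M : ℚ) * stabiliserWeight σ M)
    (finsum_kappaCount_mul_stabiliserWeight_hasAxis_core hD hE hT i)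
    (fun s hs => finsum_kappaCount_mul_stabiliserWeight_hasAxis_T1 hD hE hT s hs i)
    (fun s hs => finsum_kappaCount_mul_stabiliserWeight_hasAxis_T2 hD hE hT s hs i)
    (fun s hs => finsum_kappaCount_mul_stabiliserWeight_hasAxis_T3 hD hE hT s hs i)
    (fun ρ s hρ hs => finsum_kappaCount_mul_stabiliserWeight_hasAxis_G1 hD h2 hE hN₀ hT ρ s hρ hs i f₀ hσf₀ (hglue₀ ρ s))
    (fun ρ s hρ hs => finsum_kappaCount_mul_stabiliserWeight_hasAxis_G2 hD h2 hE hN₀ hT ρ s hρ hs i f₁ hσf₁ (hglue₁ ρ s))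
    hG3'
    (fun ρ hρ => finsum_kappaCount_mul_stabiliserWeight_hasAxis_H hD h2 hE hN₀ hT ρ hρ i f₀ hσf₀ (hglueH ρ))
    hzero
  -- (6) arithmetic: `|token| = 1`, divide by `q − 1`, and `max(0, q^k − q^{k−B}) = q^k − q^{k−B′}`
  set q : ℕ := Fintype.card 𝓀[K] with hq_def
  have hq1 : (1 : ℚ) < q := by exact_mod_cast (Fintype.one_lt_card : 1 < Fintype.card 𝓀[K])
  have hq1' : (q : ℚ) - 1 ≠ 0 := by linarith
  have hq0 : (0 : ℚ) < q := by linarith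
  -- the token has absolute value one
  have htok : |(if n₁ = n₂ ∧ n₂ = n₃ then ((((![normSign σ (-(1 + f₀)), normSign σ f₀ * normSign σ (-(1 + f₀)), normSign σ f₀] : Fin 3 → ℤ) i : ℤ) : ℚ))
      else if n₂ = n₃ then (![![(normSign σ (-1 : K) : ℚ) * normSign σ (1 + f₀), (normSign σ (-1 : K) : ℚ) * normSign σ f₀ * normSign σ (1 + f₀), (normSign σ f₀ : ℚ)],
         ![(normSign σ (-1 : K) : ℚ) * normSign σ f₁ * normSign σ (1 + f₁), (normSign σ (-1 : K) : ℚ) * normSign σ (1 + f₁), (normSign σ f₁ : ℚ)],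
         ![(normSign σ f₂ : ℚ), (normSign σ (-1 : K) : ℚ) * normSign σ f₂ * normSign σ (1 + f₂), (normSign σ (-1 : K) : ℚ) * normSign σ (1 + f₂)]] : Fin 3 → Fin 3 → ℚ) 0 i
      else if n₁ = n₃ then (![![(normSign σ (-1 : K) : ℚ) * normSign σ (1 + f₀), (normSign σ (-1 : K) : ℚ) * normSign σ f₀ * normSign σ (1 + f₀), (normSign σ f₀ : ℚ)],
         ![(normSign σ (-1 : K) : ℚ) * normSign σ f₁ * normSign σ (1 + f₁), (normSign σ (-1 : K) : ℚ) * normSign σ (1 + f₁), (normSign σ f₁ : ℚ)],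
         ![(normSign σ f₂ : ℚ), (normSign σ (-1 : K) : ℚ) * normSign σ f₂ * normSign σ (1 + f₂), (normSign σ (-1 : K) : ℚ) * normSign σ (1 + f₂)]] : Fin 3 → Fin 3 → ℚ) 1 i
      else (![![(normSign σ (-1 : K) : ℚ) * normSign σ (1 + f₀), (normSign σ (-1 : K) : ℚ) * normSign σ f₀ * normSign σ (1 + f₀), (normSign σ f₀ : ℚ)],
         ![(normSign σ (-1 : K) : ℚ) * normSign σ f₁ * normSign σ (1 + f₁), (normSign σ (-1 : K) : ℚ) * normSign σ (1 + f₁), (normSign σ f₁ : ℚ)],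
         ![(normSign σ f₂ : ℚ), (normSign σ (-1 : K) : ℚ) * normSign σ f₂ * normSign σ (1 + f₂), (normSign σ (-1 : K) : ℚ) * normSign σ (1 + f₂)]] : Fin 3 → Fin 3 → ℚ) 2 i)| = 1 := by
    have hS := abs_cast_normSign σ
    split_ifs <;> fin_cases i <;> simp [abs_mul, hS, Int.cast_mul]
  -- the exponent bookkeeping: `2B = nᵢ − d + 2 − 2·shiftR d t`, `shiftR d t = d − d % 2`
  have hshift : shiftR d t = ((d - d % 2 : ℕ) : ℤ) := rfl
  rw [hshift] at hB
  have hni : ((![n₁, n₂, n₃] : Fin 3 → ℕ) i) ≤ n₁ + n₂ + n₃ ∧ ((![n₁, n₂, n₃] : Fin 3 → ℕ) i) % 2 = d % 2 := by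
    fin_cases i
    · exact ⟨by simp; omega, by simpa using hp1⟩
    · exact ⟨by simp; omega, by simpa using hp2⟩
    · exact ⟨by simp, by simpa using hp3⟩
  set nᵢ : ℕ := ((![n₁, n₂, n₃] : Fin 3 → ℕ) i) with hnᵢ_def
  have hnum : max 0 ((q : ℚ) ^ (k : ℤ) - (q : ℚ) ^ ((k : ℤ) - B)) = (q : ℚ) ^ k - (q : ℚ) ^ (k - (nᵢ + 2 * (d % 2) + 2 - 3 * d) / 2) := by
    by_cases hnn : 3 * d ≤ nᵢ + 2 * (d % 2) + 2
    · -- `B = B′ ≥ 0`, `B′ ≤ k`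
      have hdd : d % 2 ≤ d := Nat.mod_le d 2
      have hBB : B = (((nᵢ + 2 * (d % 2) + 2 - 3 * d) / 2 : ℕ) : ℤ) := by omega
      have hBk : (nᵢ + 2 * (d % 2) + 2 - 3 * d) / 2 ≤ k := by omega
      have hexp : (k : ℤ) - B = (((k - (nᵢ + 2 * (d % 2) + 2 - 3 * d) / 2 : ℕ)) : ℤ) := by omega
      rw [hexp, zpow_natCast, zpow_natCast]
      exact max_eq_right (sub_nonneg.2 (pow_le_pow_right₀ hq1.le (Nat.sub_le _ _)))
    · -- `B < 0`: both sides vanish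
      have hB0 : (nᵢ + 2 * (d % 2) + 2 - 3 * d) / 2 = 0 := by
        have : nᵢ + 2 * (d % 2) + 2 - 3 * d = 0 := by omega
        rw [this]
      have hBneg : (k : ℤ) ≤ (k : ℤ) - B := by omega
      rw [hB0, Nat.sub_zero, sub_self]
      exact max_eq_left (sub_nonpos.2 (zpow_le_zpow_right₀ hq1.le hBneg))
  unfold ampl
  rw [hnum]
  have hsum : ∑ a : Fin 3 → Fin (n₁ + n₂ + n₃ + 1), (fun a => ∑ᶠ M ∈ stratum σ ϖ T a, (kappaCount σ ϖ 0 i M : ℚ) * stabiliserWeight σ M) (fun j => (a j : ℕ)) =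
      (if n₁ = n₂ ∧ n₂ = n₃ then ((((![normSign σ (-(1 + f₀)), normSign σ f₀ * normSign σ (-(1 + f₀)), normSign σ f₀] : Fin 3 → ℤ) i : ℤ) : ℚ))
      else if n₂ = n₃ then (![![(normSign σ (-1 : K) : ℚ) * normSign σ (1 + f₀), (normSign σ (-1 : K) : ℚ) * normSign σ f₀ * normSign σ (1 + f₀), (normSign σ f₀ : ℚ)],
         ![(normSign σ (-1 : K) : ℚ) * normSign σ f₁ * normSign σ (1 + f₁), (normSign σ (-1 : K) : ℚ) * normSign σ (1 + f₁), (normSign σ f₁ : ℚ)],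
         ![(normSign σ f₂ : ℚ), (normSign σ (-1 : K) : ℚ) * normSign σ f₂ * normSign σ (1 + f₂), (normSign σ (-1 : K) : ℚ) * normSign σ (1 + f₂)]] : Fin 3 → Fin 3 → ℚ) 0 i
      else if n₁ = n₃ then (![![(normSign σ (-1 : K) : ℚ) * normSign σ (1 + f₀), (normSign σ (-1 : K) : ℚ) * normSign σ f₀ * normSign σ (1 + f₀), (normSign σ f₀ : ℚ)],
         ![(normSign σ (-1 : K) : ℚ) * normSign σ f₁ * normSign σ (1 + f₁), (normSign σ (-1 : K) : ℚ) * normSign σ (1 + f₁), (normSign σ f₁ : ℚ)],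
         ![(normSign σ f₂ : ℚ), (normSign σ (-1 : K) : ℚ) * normSign σ f₂ * normSign σ (1 + f₂), (normSign σ (-1 : K) : ℚ) * normSign σ (1 + f₂)]] : Fin 3 → Fin 3 → ℚ) 1 i
      else (![![(normSign σ (-1 : K) : ℚ) * normSign σ (1 + f₀), (normSign σ (-1 : K) : ℚ) * normSign σ f₀ * normSign σ (1 + f₀), (normSign σ f₀ : ℚ)],
         ![(normSign σ (-1 : K) : ℚ) * normSign σ f₁ * normSign σ (1 + f₁), (normSign σ (-1 : K) : ℚ) * normSign σ (1 + f₁), (normSign σ f₁ : ℚ)],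
         ![(normSign σ f₂ : ℚ), (normSign σ (-1 : K) : ℚ) * normSign σ f₂ * normSign σ (1 + f₂), (normSign σ (-1 : K) : ℚ) * normSign σ (1 + f₂)]] : Fin 3 → Fin 3 → ℚ) 2 i) *
      (((q : ℚ) ^ k - (q : ℚ) ^ (k - (nᵢ + 2 * (d % 2) + 2 - 3 * d) / 2)) / ((q : ℚ) - 1)) := by
    rw [← mul_div_assoc, eq_div_iff hq1', mul_comm]
    exact key
  rw [hsum, abs_mul, htok, one_mul, abs_div, abs_of_pos (by linarith : (0 : ℚ) < (q : ℚ) - 1),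
    abs_of_nonneg (sub_nonneg.2 (pow_le_pow_right₀ hq1.le (Nat.sub_le _ _)))]
  ring


end Summit.HodgeConjecture.HodgeConjecture.Cruxes.H413.F0P3cDyRamKappaCountTypeZero

end
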